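import Summits.QuantumFields.YangMills.Theorems.RevelationMartingaleFreshVertexZeroIncrement
import Literature.MathematicalPhysics.QuantumFieldTheory.Balaban1983to89.B12RTGaugeInvariance254
import Literature.MathematicalPhysics.QuantumFieldTheory.Balaban1983to89.T4WilsonGaugeFlatDirection
import Literature.MathematicalPhysics.QuantumFieldTheory.Balaban1983to89.B16Sect1Backgrounds
import Literature.MathematicalPhysics.QuantumFieldTheory.Balaban1983to89.T4PairDerivBridge
import Literature.MathematicalPhysics.QuantumFieldTheory.Balaban1983to89.T3UnitScaleTilt
import HarnessLib

/-!
# Route RevelationMartingale — TREE GAUGE in the stubs' letters: forest prefixes of the bond revelation are free, and the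
# Doob increment of `dist1(Ū^j(∂p))` under `gibbsK` VANISHES at every bond with a fresh vertex (proxy `σ_i = 0`)

Cell `ym3-torus` (YM ladder rung R3 = continuum SU(2) Yang–Mills on the three-torus — a RUNG, NOT d = 4, NOT the Clay problem), width
seat `ym-ust-19936-w4` gen 9; line «revelation_martingale» on the crux `HistoryTailL` (stmt-QuantumFields-19936); helper file,
`--supports stmt-QuantumFields-19936`.  Companion of `RevelationMartingaleFreshVertexZeroIncrement` (the abstract orbit-average lemma and
the generic fresh-vertex theorem); here:

* §1 (generic `Params` ∕ gauge group): `measurePreserving_gaugeAct_gibbsMeasure` — the Wilson–Gibbs law `T4GenFunBounds.gibbsMeasure P β`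
  is GAUGE INVARIANT (product Haar is, ✓`B12RTGaugeInvariance254.measurePreserving_gaugeAct`; the Wilson action is,
  ✓`T4WilsonGaugeFlatDirection.wilsonAction_gaugeAct`); `condExp_bondReveal_succ_eq_of_le` — beyond the horizon `N ≤ i` the two masked revelation maps
  coincide, so the increment is literally `0`; ★`condExp_bondReveal_ae_eq_integral_of_forestPrefix` — if `e(0..i₀)` is revealed LEAF BY
  LEAF (each `e i`, `i < i₀`, has an endpoint no earlier bond touches: a forest grown one fresh vertex at a time, e.g. a spanning tree in
  breadth-first order), then `μ[f | σ_i] = E_μ f` a.e. for all `i ≤ i₀` (induction from `σ_0 = ⊥`, cf. ✓`bondReveal_comap_zero`).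
* §2 (the letters of `stub_levelOneBondRevelation` ∕ `stub_higherBondRevelation` in `Cruxes/HistoryTailL/Lines/revelation_martingale.lean`):
  `measurePreserving_gaugeAct_gibbsK` (the law `T3UnitScaleTilt.gibbsK F ℰp γ K` is gauge invariant), `gaugeInvariant_dist1_iter_plaqHol`
  (`dist1(Ū^j(∂p))` is gauge invariant for `j ≤ m + K`: ✓`B16Sect1Backgrounds.iter_gaugeAct`, ✓`T4ReTrLipUnitary.plaqHol_gaugeAct`,
  `dist1_conj`), `integrable_dist1_iter_plaqHol`; then, for THE bond-revelation `Filtration` `ℱ` of any enumeration `e` (hypothesis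
  `hℱ` verbatim as in the stubs) and an index `i < N` whose bond has a FRESH endpoint:
  ★★`condExp_bondReveal_succ_ae_eq_of_freshVertex_T3` (`μ[f | ℱ (i+1)] = μ[f | ℱ i]` a.e.), `doobIncrement_ae_eq_zero_of_freshVertex_T3`
  (`D_i = 0` a.e.), ★★`condExp_exp_mul_doobIncrement_le_of_freshVertex_T3` — THE STUBS' MGF CLAUSE at index `i` for every real `s` with
  the proxy read as `σ i U = 0` (`μ[exp(s·D_i) | ℱ i] ≤ exp(s²·0∕2)` a.e.), and ★`condExp_bondReveal_ae_eq_integral_of_forestPrefix_T3`.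

USE: in both bond stubs choose the enumeration «spanning tree first»; the proxies `σ_i` may be taken `≡ 0` along the tree prefix and at
every later fresh-vertex index, so the window sum `Σ_{i<N} σ_i` runs over the `N_eff = #PBond − #Site + 1` loop-closing bonds only.
HONEST SCOPE: mechanism step only — nothing about the loop-closing increments, the first-exit window or the sum `≤ Cv·g_(K−j)²`; nothing
of 23082 ∕ the stubs ∕ `HistoryTailL` ∕ a summit statement is proved.  Mathlib + tree only; def-free. [folklore]
-/

namespace Summit.QuantumFields.YangMills.Theorems.RevelationMartingaleTreeGauge

open scoped BigOperators Classical MeasureTheory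
open MeasureTheory Set Filter Literature.MathematicalPhysics.QuantumFieldTheory.Balaban1983to89
  Literature.MathematicalPhysics.QuantumFieldTheory.Balaban1983to89.T3ContinuumYM3Torus

/-! ## §1 Generic corollaries: beyond the horizon, and forest prefixes -/

section Generic

variable {P : Params} {G : Type*} [GaugeGroup G] [MeasurableSpace G] [RegularGaugeGroup G] [HaarData G]

omit [MeasurableSpace G] [RegularGaugeGroup G] [HaarData G] in
/-- Beyond the horizon (`N ≤ i`) the masked revelation maps at `i` and `i + 1` coincide (everything is revealed). [folklore] -/
theorem bondReveal_succ_eq_of_le {N : ℕ} (e : Fin N → PBond P 0) {i : ℕ} (hi : N ≤ i) :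
    (fun (U : GaugeField P 0 G) (m : Fin N) => if (m : ℕ) < i + 1 then U (e m) else (1 : G)) =
      (fun (U : GaugeField P 0 G) (m : Fin N) => if (m : ℕ) < i then U (e m) else (1 : G)) := by
  funext U m
  have h1 : (m : ℕ) < i := lt_of_lt_of_le m.2 hi
  have h2 : (m : ℕ) < i + 1 := Nat.lt_succ_of_lt h1
  simp only [h1, h2, if_true]

omit [RegularGaugeGroup G] [HaarData G] in
/-- … hence beyond the horizon the Doob increment of ANY observable under ANY measure is literally zero. [folklore] -/
theorem condExp_bondReveal_succ_eq_of_le (μ : Measure (GaugeField P 0 G)) (f : GaugeField P 0 G → ℝ)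
    {N : ℕ} (e : Fin N → PBond P 0) {i : ℕ} (hi : N ≤ i) :
    μ[f | MeasurableSpace.comap
        (fun (U : GaugeField P 0 G) (m : Fin N) => if (m : ℕ) < i + 1 then U (e m) else (1 : G)) inferInstance]
      = μ[f | MeasurableSpace.comap
        (fun (U : GaugeField P 0 G) (m : Fin N) => if (m : ℕ) < i then U (e m) else (1 : G)) inferInstance] := by
  rw [bondReveal_succ_eq_of_le e hi]

/-- **FOREST PREFIXES ARE FREE.**  If the first `i₀` bonds of the enumeration are revealed LEAF BY LEAF — each `e i`, `i < i₀`, has an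
endpoint touched by no earlier bond, i.e. `e(0..i₀)` is a forest grown one fresh vertex at a time (e.g. a spanning tree of the support
in breadth-first order) — then along that prefix the revelation martingale of a gauge-invariant integrable `f` under a gauge-invariant
probability law is CONSTANT: `μ[f | σ_i] = E_μ f` a.e. for every `i ≤ i₀` (axial∕tree gauge, in conditional-expectation form).
[folklore] -/
theorem condExp_bondReveal_ae_eq_integral_of_forestPrefix (μ : Measure (GaugeField P 0 G)) [IsProbabilityMeasure μ]
    (hμ : ∀ u : GaugeTransf P 0 G, MeasurePreserving (GaugeField.gaugeAct u) μ μ)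
    {f : GaugeField P 0 G → ℝ} (hf : Integrable f μ) (hfinv : GaugeField.GaugeInvariant f)
    {N : ℕ} (e : Fin N → PBond P 0) (i₀ : ℕ) (hi₀ : i₀ ≤ N)
    (hforest : ∀ (i : ℕ) (hi : i < i₀), ∃ x : Site P 0,
        ((e ⟨i, lt_of_lt_of_le hi hi₀⟩).src = x ∨ (e ⟨i, lt_of_lt_of_le hi hi₀⟩).tgt = x) ∧
        ∀ m : Fin N, (m : ℕ) < i → (e m).src ≠ x ∧ (e m).tgt ≠ x) :
    ∀ i, i ≤ i₀ → μ[f | MeasurableSpace.comap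
        (fun (U : GaugeField P 0 G) (m : Fin N) => if (m : ℕ) < i then U (e m) else (1 : G)) inferInstance]
      =ᵐ[μ] fun _ => ∫ U, f U ∂μ := by
  intro i
  induction i with
  | zero =>
      intro _
      have h0 : MeasurableSpace.comap (fun (U : GaugeField P 0 G) (m : Fin N) => if (m : ℕ) < 0 then U (e m) else (1 : G))
          inferInstance = (⊥ : MeasurableSpace (GaugeField P 0 G)) := by
        rw [show (fun (U : GaugeField P 0 G) (m : Fin N) => if (m : ℕ) < 0 then U (e m) else (1 : G)) = fun _ _ => (1 : G) from
          funext fun U => funext fun m => by simp]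
        exact MeasurableSpace.comap_const _
      rw [h0, condExp_bot]
  | succ i ih =>
      intro hi
      have hi' : i < i₀ := Nat.lt_of_succ_le hi
      obtain ⟨x, hx, hfresh⟩ := hforest i hi'
      exact (condExp_bondReveal_succ_ae_eq_of_freshVertex μ hμ hf hfinv e (lt_of_lt_of_le hi' hi₀) hx hfresh).trans
        (ih hi'.le)

/-- **THE WILSON–GIBBS LAW IS GAUGE INVARIANT**: every gauge transformation `U ↦ U^u` preserves
`T4GenFunBounds.gibbsMeasure P β = Z⁻¹·e^{−βA(U)}·dU` (product Haar `dU` is gauge invariant, ✓`measurePreserving_gaugeAct`, and so is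
the Wilson action, ✓`wilsonAction_gaugeAct`). [folklore] -/
theorem measurePreserving_gaugeAct_gibbsMeasure (P : Params) (β : ℝ) (u : GaugeTransf P 0 G) :
    MeasurePreserving (GaugeField.gaugeAct u) (T4GenFunBounds.gibbsMeasure (G := G) P β)
      (T4GenFunBounds.gibbsMeasure P β) := by
  have hT := B12RTGaugeInvariance254.measurePreserving_gaugeAct (P := P) (j := 0) (G := G) u
  have hρ : Measurable fun U : GaugeField P 0 G => ENNReal.ofReal (Missing.boltzmann P β U) :=
    T4GenFunBounds.measurable_ofReal_boltzmann P β
  have hρinv : ∀ U : GaugeField P 0 G, Missing.boltzmann P β (GaugeField.gaugeAct u U) = Missing.boltzmann P β U := by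
    intro U
    unfold Missing.boltzmann
    rw [show wilsonAction4 (GaugeField.gaugeAct u U) = wilsonAction4 U from
      T4WilsonGaugeFlatDirection.wilsonAction_gaugeAct 1 u U]
  refine ⟨hT.measurable, ?_⟩
  rw [T4GenFunBounds.gibbsMeasure, Measure.map_smul]
  congr 1
  ext s hs
  rw [Measure.map_apply hT.measurable hs, withDensity_apply _ hs, withDensity_apply _ (hT.measurable hs),
    ← hT.map_eq, setLIntegral_map hs hρ hT.measurable, hT.map_eq]
  exact setLIntegral_congr_fun (hT.measurable hs) (fun U _ => by rw [hρinv U])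

end Generic

/-! ## §2 The stubs' letters: `gibbsK F ℰp γ K` and `dist1(Ū^j(∂p))` on `SU(2)` -/

section T3

/-- The Wilson–Gibbs law `gibbsK` of the `K`-th approximation is gauge invariant. [folklore] -/
theorem measurePreserving_gaugeAct_gibbsK (F : T3Family) (γ : ℝ) (K : ℕ)
    (u : GaugeTransf (F.P K) 0 (Matrix.specialUnitaryGroup (Fin 2) ℂ)) :
    MeasurePreserving (GaugeField.gaugeAct u) (T3UnitScaleTilt.gibbsK F T3UnitLawDensityEML.ℰp γ K)
      (T3UnitScaleTilt.gibbsK F T3UnitLawDensityEML.ℰp γ K) :=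
  measurePreserving_gaugeAct_gibbsMeasure (F.P K) _ u

/-- The observable `dist1(Ū^j(∂p))` of the stubs is GAUGE INVARIANT (covariance of the iterated block averaging in the standing range,
✓`B16Sect1Backgrounds.iter_gaugeAct`; `U^u(∂p) = u(p₋)U(∂p)u(p₋)⁻¹`, ✓`plaqHol_gaugeAct`; `dist1` is a class function). [folklore] -/
theorem gaugeInvariant_dist1_iter_plaqHol (F : T3Family) (K j : ℕ) (hj : j ≤ F.m + K) (p : Plaq (F.P K) j) :
    GaugeField.GaugeInvariant fun U : GaugeField (F.P K) 0 (Matrix.specialUnitaryGroup (Fin 2) ℂ) =>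
      GaugeGroup.dist1 (GaugeField.plaqHol
        (Averaging.iter (fun i => BlockAveraging.blockAvg (P := F.P K) (j := i) T3UnitLawDensityEML.ℰp) j U) p) := by
  intro u U
  have hj' : j ≤ (F.P K).m + (F.P K).K := hj
  simp only []
  rw [B16Sect1Backgrounds.iter_gaugeAct _ u U j hj', T4ReTrLipUnitary.plaqHol_gaugeAct, GaugeGroup.dist1_conj]

/-- … and integrable under `gibbsK` (`0 ≤ dist1 ≤ 2` on `SU(2)`, measurable, probability measure). [folklore] -/
theorem integrable_dist1_iter_plaqHol (F : T3Family) {γ : ℝ} (hγ : 0 ≤ γ) (K j : ℕ) (p : Plaq (F.P K) j) :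
    Integrable (fun U : GaugeField (F.P K) 0 (Matrix.specialUnitaryGroup (Fin 2) ℂ) =>
      GaugeGroup.dist1 (GaugeField.plaqHol
        (Averaging.iter (fun i => BlockAveraging.blockAvg (P := F.P K) (j := i) T3UnitLawDensityEML.ℰp) j U) p))
      (T3UnitScaleTilt.gibbsK F T3UnitLawDensityEML.ℰp γ K) := by
  haveI := T3UnitScaleTilt.isProbabilityMeasure_gibbsK F T3UnitLawDensityEML.ℰp
    (G := Matrix.specialUnitaryGroup (Fin 2) ℂ) hγ K
  have hmeas : Measurable fun U : GaugeField (F.P K) 0 (Matrix.specialUnitaryGroup (Fin 2) ℂ) =>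
      GaugeGroup.dist1 (GaugeField.plaqHol
        (Averaging.iter (fun i => BlockAveraging.blockAvg (P := F.P K) (j := i) T3UnitLawDensityEML.ℰp) j U) p) :=
    RegularGaugeGroup.measurable_dist1.comp ((Missing.measurable_plaqHol p).comp
      (T4Continuum.measurable_iter _
        (F.avgMeasurable_of_measurableE T3UnitLawDensityEML.ℰp T3UnitLawDensityEML.measurableE_ℰp K) j))
  refine Integrable.of_mem_Icc 0 2 hmeas.aemeasurable
    (Eventually.of_forall fun U => ⟨GaugeGroup.dist1_nonneg _, T4PairDerivBridge.dist1_le_two_specialUnitaryGroup _⟩)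

/-- **FRESH VERTEX ⇒ ZERO INCREMENT, in the letters of LINE 13's bond stubs** (`stub_levelOneBondRevelation` ∕ `stub_higherBondRevelation`
of `Cruxes/HistoryTailL/Lines/revelation_martingale.lean`): for the Wilson–Gibbs law `gibbsK F ℰp γ K` (`0 ≤ γ`), the observable
`f = dist1(Ū^j(∂p))` (`j ≤ m + K`), ANY enumeration `e : Fin N → PBond (F.P K) 0` and THE bond-revelation filtration `ℱ` of `e`, if the
bond `e i` has an endpoint `x` that no earlier bond touches, then `μ[f | ℱ (i+1)] = μ[f | ℱ i]` a.e. — the `i`-th Doob increment vanishes.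
Nothing of the stubs' proxy SUM on the window is asserted: this prices the forest part of the revelation at exactly `0`. [folklore] -/
theorem condExp_bondReveal_succ_ae_eq_of_freshVertex_T3 (F : T3Family) {γ : ℝ} (hγ : 0 ≤ γ) (K j : ℕ) (hj : j ≤ F.m + K)
    (p : Plaq (F.P K) j) {N : ℕ} (e : Fin N → PBond (F.P K) 0)
    (ℱ : MeasureTheory.Filtration ℕ
      (inferInstance : MeasurableSpace (GaugeField (F.P K) 0 (Matrix.specialUnitaryGroup (Fin 2) ℂ))))
    (hℱ : ∀ i, ℱ i = MeasurableSpace.comap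
      (fun (U : GaugeField (F.P K) 0 (Matrix.specialUnitaryGroup (Fin 2) ℂ)) (m : Fin N) =>
        if (m : ℕ) < i then U (e m) else (1 : Matrix.specialUnitaryGroup (Fin 2) ℂ)) inferInstance)
    {i : ℕ} (hi : i < N) {x : Site (F.P K) 0} (hx : (e ⟨i, hi⟩).src = x ∨ (e ⟨i, hi⟩).tgt = x)
    (hfresh : ∀ m : Fin N, (m : ℕ) < i → (e m).src ≠ x ∧ (e m).tgt ≠ x) :
    MeasureTheory.condExp (ℱ (i + 1)) (T3UnitScaleTilt.gibbsK F T3UnitLawDensityEML.ℰp γ K)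
        (fun V => GaugeGroup.dist1 (GaugeField.plaqHol
          (Averaging.iter (fun i => BlockAveraging.blockAvg (P := F.P K) (j := i) T3UnitLawDensityEML.ℰp) j V) p))
      =ᵐ[T3UnitScaleTilt.gibbsK F T3UnitLawDensityEML.ℰp γ K]
    MeasureTheory.condExp (ℱ i) (T3UnitScaleTilt.gibbsK F T3UnitLawDensityEML.ℰp γ K)
        (fun V => GaugeGroup.dist1 (GaugeField.plaqHol
          (Averaging.iter (fun i => BlockAveraging.blockAvg (P := F.P K) (j := i) T3UnitLawDensityEML.ℰp) j V) p)) := by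
  haveI := T3UnitScaleTilt.isProbabilityMeasure_gibbsK F T3UnitLawDensityEML.ℰp
    (G := Matrix.specialUnitaryGroup (Fin 2) ℂ) hγ K
  rw [hℱ (i + 1), hℱ i]
  exact condExp_bondReveal_succ_ae_eq_of_freshVertex _ (measurePreserving_gaugeAct_gibbsK F γ K)
    (integrable_dist1_iter_plaqHol F hγ K j p) (gaugeInvariant_dist1_iter_plaqHol F K j hj p) e hi hx hfresh

/-- … so the `i`-th DOOB INCREMENT `D_i = μ[f | ℱ (i+1)] − μ[f | ℱ i]` of the stubs is `0` a.e. [folklore] -/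
theorem doobIncrement_ae_eq_zero_of_freshVertex_T3 (F : T3Family) {γ : ℝ} (hγ : 0 ≤ γ) (K j : ℕ) (hj : j ≤ F.m + K)
    (p : Plaq (F.P K) j) {N : ℕ} (e : Fin N → PBond (F.P K) 0)
    (ℱ : MeasureTheory.Filtration ℕ
      (inferInstance : MeasurableSpace (GaugeField (F.P K) 0 (Matrix.specialUnitaryGroup (Fin 2) ℂ))))
    (hℱ : ∀ i, ℱ i = MeasurableSpace.comap
      (fun (U : GaugeField (F.P K) 0 (Matrix.specialUnitaryGroup (Fin 2) ℂ)) (m : Fin N) =>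
        if (m : ℕ) < i then U (e m) else (1 : Matrix.specialUnitaryGroup (Fin 2) ℂ)) inferInstance)
    {i : ℕ} (hi : i < N) {x : Site (F.P K) 0} (hx : (e ⟨i, hi⟩).src = x ∨ (e ⟨i, hi⟩).tgt = x)
    (hfresh : ∀ m : Fin N, (m : ℕ) < i → (e m).src ≠ x ∧ (e m).tgt ≠ x) :
    ∀ᵐ U ∂(T3UnitScaleTilt.gibbsK F T3UnitLawDensityEML.ℰp γ K),
      MeasureTheory.condExp (ℱ (i + 1)) (T3UnitScaleTilt.gibbsK F T3UnitLawDensityEML.ℰp γ K)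
          (fun V => GaugeGroup.dist1 (GaugeField.plaqHol
            (Averaging.iter (fun i => BlockAveraging.blockAvg (P := F.P K) (j := i) T3UnitLawDensityEML.ℰp) j V) p)) U -
        MeasureTheory.condExp (ℱ i) (T3UnitScaleTilt.gibbsK F T3UnitLawDensityEML.ℰp γ K)
          (fun V => GaugeGroup.dist1 (GaugeField.plaqHol
            (Averaging.iter (fun i => BlockAveraging.blockAvg (P := F.P K) (j := i) T3UnitLawDensityEML.ℰp) j V) p)) U = 0 := by
  filter_upwards [condExp_bondReveal_succ_ae_eq_of_freshVertex_T3 F hγ K j hj p e ℱ hℱ hi hx hfresh] with U hU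
  rw [hU, sub_self]

/-- **THE STUBS' MGF CLAUSE AT A FRESH-VERTEX INDEX, WITH PROXY `σ_i = 0`**: for every real `s`, a.e.
`μ[exp(s·D_i) | ℱ i] ≤ exp(s²·0∕2)` — the conditional sub-Gaussian row of `stub_levelOneBondRevelation` ∕ `stub_higherBondRevelation`
at index `i`, read with `σ i U = 0` (the increment is `0` a.e., so the conditional exponential moment is `1`).  Consequently the
proxies of both bond stubs need to be non-zero only at the LOOP-CLOSING bonds of the enumeration. [folklore] -/
theorem condExp_exp_mul_doobIncrement_le_of_freshVertex_T3 (F : T3Family) {γ : ℝ} (hγ : 0 ≤ γ) (K j : ℕ) (hj : j ≤ F.m + K)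
    (p : Plaq (F.P K) j) {N : ℕ} (e : Fin N → PBond (F.P K) 0)
    (ℱ : MeasureTheory.Filtration ℕ
      (inferInstance : MeasurableSpace (GaugeField (F.P K) 0 (Matrix.specialUnitaryGroup (Fin 2) ℂ))))
    (hℱ : ∀ i, ℱ i = MeasurableSpace.comap
      (fun (U : GaugeField (F.P K) 0 (Matrix.specialUnitaryGroup (Fin 2) ℂ)) (m : Fin N) =>
        if (m : ℕ) < i then U (e m) else (1 : Matrix.specialUnitaryGroup (Fin 2) ℂ)) inferInstance)
    {i : ℕ} (hi : i < N) {x : Site (F.P K) 0} (hx : (e ⟨i, hi⟩).src = x ∨ (e ⟨i, hi⟩).tgt = x)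
    (hfresh : ∀ m : Fin N, (m : ℕ) < i → (e m).src ≠ x ∧ (e m).tgt ≠ x) (s : ℝ) :
    ∀ᵐ U ∂(T3UnitScaleTilt.gibbsK F T3UnitLawDensityEML.ℰp γ K),
      MeasureTheory.condExp (ℱ i) (T3UnitScaleTilt.gibbsK F T3UnitLawDensityEML.ℰp γ K)
        (fun U' => Real.exp (s *
          (MeasureTheory.condExp (ℱ (i + 1)) (T3UnitScaleTilt.gibbsK F T3UnitLawDensityEML.ℰp γ K)
              (fun V => GaugeGroup.dist1 (GaugeField.plaqHol
                (Averaging.iter (fun i => BlockAveraging.blockAvg (P := F.P K) (j := i) T3UnitLawDensityEML.ℰp) j V) p)) U' -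
           MeasureTheory.condExp (ℱ i) (T3UnitScaleTilt.gibbsK F T3UnitLawDensityEML.ℰp γ K)
              (fun V => GaugeGroup.dist1 (GaugeField.plaqHol
                (Averaging.iter (fun i => BlockAveraging.blockAvg (P := F.P K) (j := i) T3UnitLawDensityEML.ℰp) j V) p)) U'))) U
        ≤ Real.exp (s ^ 2 * 0 / 2) := by
  haveI := T3UnitScaleTilt.isProbabilityMeasure_gibbsK F T3UnitLawDensityEML.ℰp
    (G := Matrix.specialUnitaryGroup (Fin 2) ℂ) hγ K
  have h0 := doobIncrement_ae_eq_zero_of_freshVertex_T3 F hγ K j hj p e ℱ hℱ hi hx hfresh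
  have hg : (fun U' => Real.exp (s *
          (MeasureTheory.condExp (ℱ (i + 1)) (T3UnitScaleTilt.gibbsK F T3UnitLawDensityEML.ℰp γ K)
              (fun V => GaugeGroup.dist1 (GaugeField.plaqHol
                (Averaging.iter (fun i => BlockAveraging.blockAvg (P := F.P K) (j := i) T3UnitLawDensityEML.ℰp) j V) p)) U' -
           MeasureTheory.condExp (ℱ i) (T3UnitScaleTilt.gibbsK F T3UnitLawDensityEML.ℰp γ K)
              (fun V => GaugeGroup.dist1 (GaugeField.plaqHol
                (Averaging.iter (fun i => BlockAveraging.blockAvg (P := F.P K) (j := i) T3UnitLawDensityEML.ℰp) j V) p)) U')))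
      =ᵐ[T3UnitScaleTilt.gibbsK F T3UnitLawDensityEML.ℰp γ K] fun _ => (1 : ℝ) := by
    filter_upwards [h0] with U hU
    rw [hU, mul_zero, Real.exp_zero]
  have hc : MeasureTheory.condExp (ℱ i) (T3UnitScaleTilt.gibbsK F T3UnitLawDensityEML.ℰp γ K)
      (fun _ : GaugeField (F.P K) 0 (Matrix.specialUnitaryGroup (Fin 2) ℂ) => (1 : ℝ)) = fun _ => (1 : ℝ) :=
    condExp_const (ℱ.le i) (1 : ℝ)
  filter_upwards [condExp_congr_ae (m := ℱ i) hg] with U hU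
  rw [hU, hc, mul_zero, zero_div, Real.exp_zero]

/-- **FOREST PREFIXES ARE FREE, in the stubs' letters**: if `e(0..i₀)` is revealed leaf by leaf (every `e i`, `i < i₀`, has an endpoint
touched by no earlier bond), then `μ[f | ℱ i] = E_μ f` a.e. for every `i ≤ i₀` — the revelation martingale of `dist1(Ū^j(∂p))` does not
move before the first loop is closed. [folklore] -/
theorem condExp_bondReveal_ae_eq_integral_of_forestPrefix_T3 (F : T3Family) {γ : ℝ} (hγ : 0 ≤ γ) (K j : ℕ) (hj : j ≤ F.m + K)
    (p : Plaq (F.P K) j) {N : ℕ} (e : Fin N → PBond (F.P K) 0)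
    (ℱ : MeasureTheory.Filtration ℕ
      (inferInstance : MeasurableSpace (GaugeField (F.P K) 0 (Matrix.specialUnitaryGroup (Fin 2) ℂ))))
    (hℱ : ∀ i, ℱ i = MeasurableSpace.comap
      (fun (U : GaugeField (F.P K) 0 (Matrix.specialUnitaryGroup (Fin 2) ℂ)) (m : Fin N) =>
        if (m : ℕ) < i then U (e m) else (1 : Matrix.specialUnitaryGroup (Fin 2) ℂ)) inferInstance)
    (i₀ : ℕ) (hi₀ : i₀ ≤ N)
    (hforest : ∀ (i : ℕ) (hi : i < i₀), ∃ x : Site (F.P K) 0,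
        ((e ⟨i, lt_of_lt_of_le hi hi₀⟩).src = x ∨ (e ⟨i, lt_of_lt_of_le hi hi₀⟩).tgt = x) ∧
        ∀ m : Fin N, (m : ℕ) < i → (e m).src ≠ x ∧ (e m).tgt ≠ x) (i : ℕ) (hi : i ≤ i₀) :
    MeasureTheory.condExp (ℱ i) (T3UnitScaleTilt.gibbsK F T3UnitLawDensityEML.ℰp γ K)
        (fun V => GaugeGroup.dist1 (GaugeField.plaqHol
          (Averaging.iter (fun i => BlockAveraging.blockAvg (P := F.P K) (j := i) T3UnitLawDensityEML.ℰp) j V) p))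
      =ᵐ[T3UnitScaleTilt.gibbsK F T3UnitLawDensityEML.ℰp γ K]
    fun _ => ∫ V, GaugeGroup.dist1 (GaugeField.plaqHol
          (Averaging.iter (fun i => BlockAveraging.blockAvg (P := F.P K) (j := i) T3UnitLawDensityEML.ℰp) j V) p)
        ∂(T3UnitScaleTilt.gibbsK F T3UnitLawDensityEML.ℰp γ K) := by
  haveI := T3UnitScaleTilt.isProbabilityMeasure_gibbsK F T3UnitLawDensityEML.ℰp
    (G := Matrix.specialUnitaryGroup (Fin 2) ℂ) hγ K
  rw [hℱ i]
  exact condExp_bondReveal_ae_eq_integral_of_forestPrefix _ (measurePreserving_gaugeAct_gibbsK F γ K)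
    (integrable_dist1_iter_plaqHol F hγ K j p) (gaugeInvariant_dist1_iter_plaqHol F K j hj p) e i₀ hi₀ hforest i hi

end T3

end Summit.QuantumFields.YangMills.Theorems.RevelationMartingaleTreeGauge
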